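import Summits.CriticalPhenomena.CardyFormulaZ2.Theorems.CardySusyWardParafermionFamiliesToSLESixAnchorBulk

/-!
# Line `cauchy-kernel-stagger-residue` — the discrete Cauchy integral formula of the spin-`1/3` parafermion
# (crux `CardySusyWard.ParafermionFamiliesToSLESix`, stmt-CriticalPhenomena-10814; strategist r1, 2026-08-17)

The crux AS TYPED is `H ∨ SLE6LimitZ2AllDiscretisations` (landed iff), and `¬ VertexVanishes anchorDomain anchorData → crux`
is landed (`parafermionFamiliesToSLESix_of_not_vertexVanishes_anchorData`, lead c5).  Every earlier line attacks
`¬ VertexVanishes` through an ENVELOPE of the vertex field (UIE / Koebe): dead at the `δ^{1/12}` signed-collar deficit.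

THIS LINE uses a different lever.  The half-CR vertex relation (landed, `χ = i`) summed against an ARBITRARY `C^{1,1}` weight
`w` gives the general weighted Green identity (stub A, provable now; the landed moment identity is its special case `w = z̄`):

  `Wall(w) + (δ/2)·[((1+i)/2)·Σ_int ∂̄w·G − ((1−i)/2)·Σ_int ŝ_k ∂w·G] = O(1)`,   `ŝ = (−1, +1, −1, +1)` on `NW, NE, SE, SW`,

with a TRIVIAL remainder (`‖G‖ ≤ 1`, `#S_max = O(δ^{-2})`).  Two interior functionals appear: the `∂̄w`-pairing of the
symmetric corner sum (= `2cos(π/12)` × the VERTEX observable, by the landed bridge) and the `∂w`-pairing of the STAGGERED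
corner field (the combination the half-CR relation leaves free = the missing half of discrete Cauchy–Riemann).  Choose
`w = (1 − χ₀(z))/z`: the Cauchy kernel at the centre `0` of the diagonal anchor square, smoothly cut off inside the unit ball.
Then `∂̄w = −∂̄χ₀/z` is compactly supported inside `Ω`, so under `VertexVanishes` its pairing is `o(δ^{-5/3})` (stub D,
provable now); the wall side is the CAUCHY MOMENT of the phased touch measure, `Σ_wall coeff_k G(p,k)/(δẑ_p)`, whose terms are
the terms of the landed anchor first moment reweighted by the POSITIVE factor `1/|δẑ_p|²` (`1/z = z̄/|z|²`), hence it inherits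
the cone bound: `≥ c δ^{-2/3}` (stub B, provable now by the `AnchorMoment` machinery).  What is left is ONE asymptotic
statement about the staggered field (stub C = X, the open heart): its pairing with `∂w = −(1−χ₀)/z² − ∂χ₀/z` is `o(δ^{-5/3})`.
In Duminil-Copin–Smirnov's world X holds (there `L(∂̄w) → Wall(w)` for EVERY smooth `w` by Cauchy–Pompeiu, so the staggered
pairing tends to `0`); in the vanishing world it fails (the staggered field must carry the whole Cauchy integral).  So
A ∧ B ∧ C ∧ D ⇒ `¬ VertexVanishes anchorDomain anchorData` ⇒ `H` ⇒ crux.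

X is implied by EITHER input the pool already bets on — the envelope (UIE kills the collar part unsigned) OR any exact
lattice identity writing the staggered combination as the divergence of a BOUNDED local current (the route's own
Ward-identity mechanism, cruxes #2/#6): for such an identity the boundary flux is `O(δ^{-1}) = o(δ^{-5/3})` trivially, so no
boundary analysis is needed.  It is NOT implied by, and does not imply, any unsigned arm estimate.

Statements are `def … : Prop`; the registered stubs are the `theorem stub_* := by sorry`; the composition
`not_vertexVanishes_anchorData_of_cauchy` (→ `¬ VertexVanishes`) and `ParafermionFamiliesToSLESix_of` are sorry-free.
-/

noncomputable section

namespace Summit.CriticalPhenomena.CardyFormulaZ2.Cruxes.ParafermionFamiliesToSLESix.CauchyKernelStaggerResidue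

open MeasureTheory Filter Set Metric
open scoped Topology BigOperators
open Literature.Probability.LatticeModels (DiscreteDobrushin MedialVertex Site medialPoint)
open Literature.Probability.RandomPlanarGeometry (DobrushinDomain)
open Literature.Barriers.CriticalPhenomena (medialVertexOf)
open Literature.Barriers.CriticalPhenomena.HalfCRGreen (coeff twin)
open Summit.CriticalPhenomena.CardyFormulaZ2.Theses.CardySusyWard (ParafermionFamiliesToSLESix)
open Summit.CriticalPhenomena.CardyFormulaZ2.Theorems.ParafermionPrecompact.Negative (IsFamily)
open Summit.CriticalPhenomena.CardyFormulaZ2.Theorems.ParafermionFamiliesToSLESix.StripAnchored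
open Summit.CriticalPhenomena.CardyFormulaZ2.Theorems.ParafermionFamiliesToSLESix.StripAnchored.S5 (anchorDomain)

/-! ## Vocabulary: the three functionals of the general weighted Green identity -/

/-- The staggered sign `ŝ_k = (−1, +1, −1, +1)` on the corners `NW, NE, SE, SW`: `coeff i k · d_k = ((1−i)/2)·ŝ_k` with
`d_k = ẑ_{twin} − ẑ_p` the twin offsets `(−1+i)/2, (1+i)/2, (1−i)/2, (−1−i)/2` (`WeightedGreen.medialPoint_twin_sub`). -/
def stagSign (k : Fin 4) : ℂ := ![-1, 1, -1, 1] k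

open Classical in
/-- The INTERIOR `∂̄`-PAIRING: `Σ_{p random} Σ_{k : twin random} g(z_p) · G(p,k)` with `z_p = medialPoint δ (medialVertexOf p)`
(ordered internal corners, each corner counted from both of its medial vertices; by the landed bridge this is
`2cos(π/12)·Σ_p g(z_p)·vertexObs` at vertices all of whose twins are random). -/
def dbarSum (E : DiscreteDobrushin) (δ : ℝ) (g : ℂ → ℂ) : ℂ :=
  ∑ᶠ p : Site 2 × Fin 2, if IsRandomMV E p then
    ∑ k : Fin 4, (if IsRandomMV E (twin p.1 p.2 k) then g (medialPoint δ (medialVertexOf p)) * G E δ p k else 0)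
    else 0

open Classical in
/-- The INTERIOR STAGGERED PAIRING: `Σ_{p random} Σ_{k : twin random} ŝ_k · g(z_p) · G(p,k)` — the pairing of the weight `g`
with the staggered corner field (the combination left free by the half-CR vertex relation). -/
def stagSum (E : DiscreteDobrushin) (δ : ℝ) (g : ℂ → ℂ) : ℂ :=
  ∑ᶠ p : Site 2 × Fin 2, if IsRandomMV E p then
    ∑ k : Fin 4, (if IsRandomMV E (twin p.1 p.2 k) then stagSign k * g (medialPoint δ (medialVertexOf p)) * G E δ p k
      else 0)
    else 0

open Classical in
/-- The WALL FUNCTIONAL of the weight `g`: `Σ_{p random} Σ_{k : twin NOT random} g(z_p) · coeff i k · G(p,k)` (the landed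
`momentSum` is the case `g(z) = conj(z)/δ`). Wall corners carry deterministic touch phases times touch probabilities. -/
def wallW (E : DiscreteDobrushin) (δ : ℝ) (g : ℂ → ℂ) : ℂ :=
  ∑ᶠ p : Site 2 × Fin 2, if IsRandomMV E p then
    ∑ k : Fin 4, (if IsRandomMV E (twin p.1 p.2 k) then 0 else g (medialPoint δ (medialVertexOf p)) * coeff Complex.I k * G E δ p k)
    else 0

/-- `C^{1,1}` data of a weight: `w` with Wirtinger derivatives `wd = ∂w`, `wdb = ∂̄w` and a uniform second-order Taylor bound. -/
def TaylorBound (w wd wdb : ℂ → ℂ) (C : ℝ) : Prop :=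
  ∀ z h : ℂ, ‖w (z + h) - w z - (wd z * h + wdb z * (starRingEnd ℂ) h)‖ ≤ C * ‖h‖ ^ 2

/-! ## The four statements of the line -/

/-- (A) GENERAL WEIGHTED GREEN IDENTITY (L, provable now: half-CR at every random vertex, landed as `stub_halfCRVertexRelation` /
`S2.halfCRLayer_of_dobrushinDomain`, times an arbitrary `C^{1,1}` weight, telescoped over twin pairs exactly as in the landed
`stub_weightedGreen`; `coeff_k·conj(d_k) = −(1+i)/2`, `coeff_k·d_k = ((1−i)/2)ŝ_k`; remainder `≤ C·δ²·#S_max·sup‖G‖ = O(1)` by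
`norm_cornerObs_le_one` and `TotalSmall.finite_random`-type counting): along every family, eventually in `δ`,
`‖wallW w + (δ/2)·(((1+i)/2)·dbarSum ∂̄w − ((1−i)/2)·stagSum ∂w)‖ ≤ C'`. -/
def GeneralWeightedGreen : Prop :=
  ∀ (D : DobrushinDomain) (Λ : ℝ → DiscreteDobrushin), IsFamily D Λ →
    ∀ (w wd wdb : ℂ → ℂ) (C : ℝ), TaylorBound w wd wdb C →
      ∃ C' : ℝ, ∀ᶠ δ in 𝓝[>] (0:ℝ),
        ‖wallW (Λ δ) δ w + ((δ : ℂ) / 2) *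
            ((1 + Complex.I) / 2 * dbarSum (Λ δ) δ wdb - (1 - Complex.I) / 2 * stagSum (Λ δ) δ wd)‖ ≤ C'

/-- (B) CAUCHY WALL MOMENT LOWER BOUND (M/L, provable now): along the concrete anchor family, for every weight that IS the
Cauchy kernel `1/z` (centre `0` of the diagonal square `{|x ± y| < 2}`) outside the unit ball — hence at every wall corner,
eventually — `c·δ^{-2/3} ≤ ‖wallW (anchorData δ) δ g‖`.  Proof route: the wall terms are those of the landed anchor first
moment (`momentSum`, `AnchorMoment.lower_bound`, cone tables `AnchorCone.*`, `S5.touchProb_lower` = Ikhlef–Ponsaing + RSW)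
multiplied by the positive, slowly varying factor `δ/|δẑ_p|² ∈ [δ/4, δ/2]` (`1/z = z̄/|z|²`): the functional
`Φ = (Re + Im)/2` and the face pairing of the upper-left side go through with an `O(δ)` relative perturbation. -/
def CauchyWallLower : Prop :=
  ∃ c : ℝ, 0 < c ∧ ∀ g : ℂ → ℂ, (∀ z : ℂ, 1 ≤ ‖z‖ → g z = z⁻¹) →
    ∀ᶠ δ in 𝓝[>] (0:ℝ), c * δ ^ (-(2:ℝ) / 3) ≤ ‖wallW (anchorData δ) δ g‖

/-- (C) = X, THE OPEN HEART — STAGGERED CAUCHY PAIRING NEGLIGIBLE: there is a `C^{1,1}` cut-off Cauchy kernel `w` (`w = 1/z`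
off the unit ball, `∂̄w` bounded and supported in a compact subset of the square) whose `∂`-weight `wd` has staggered pairing
`o(δ^{-5/3})` along `anchorData`.  TRUE in Duminil-Copin–Smirnov's world (the missing Cauchy–Riemann half holds weakly up to
the boundary: `L(∂̄w) → Wall(w)` for all smooth `w` by Cauchy–Pompeiu), FALSE in the vanishing world (A+B+D force the
staggered field to carry the whole boundary Cauchy integral).  Sufficient: UIE (collar part unsigned-small, bulk part by
VertexVanishes — but then one proves ¬VV directly), OR an exact identity `staggered combination = div(bounded local current)`
(boundary flux `O(δ^{-1})`, interior by parts `O(δ^{-1})`).  Unsigned bounds give only `O(δ^{-7/4})`. -/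
def StaggerCauchyKernel : Prop :=
  ∃ (w wd wdb : ℂ → ℂ) (C Cb : ℝ) (K : Set ℂ),
    TaylorBound w wd wdb C ∧ (∀ z : ℂ, ‖wdb z‖ ≤ Cb) ∧ (∀ z : ℂ, 1 ≤ ‖z‖ → w z = z⁻¹) ∧
    IsCompact K ∧ K ⊆ anchorDomain.carrier ∧ (∀ z : ℂ, z ∉ K → wdb z = 0) ∧
    ∀ η > (0:ℝ), ∀ᶠ δ in 𝓝[>] (0:ℝ), ‖stagSum (anchorData δ) δ wd‖ ≤ η * δ ^ (-(5:ℝ) / 3)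

/-- (D) COMPACT `∂̄`-PAIRINGS VANISH UNDER VERTEX VANISHING (M, provable now): along a family with `VertexVanishes`, the pairing
of the corner field with a bounded weight supported in a compact `K ⊆ Ω` is `o(δ^{-5/3})` — eventually every medial vertex
over `K` has all four twins random, so by the landed bridge (`stub_vertexCornerBridge_unfolded`) the inner sum is
`2cos(π/12)·g(z_p)·vertexObs`, and `#{p : z_p ∈ K} = O(δ^{-2})` (`AnchorMomentCount`-type counting) times `o(δ^{1/3})`
(`VanishesOn Λ K`) is `o(δ^{-5/3})`. -/
def CompactDbarOfVanishing : Prop :=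
  ∀ (D : DobrushinDomain) (Λ : ℝ → DiscreteDobrushin), IsFamily D Λ → VertexVanishes D Λ →
    ∀ (g : ℂ → ℂ) (Cb : ℝ), (∀ z : ℂ, ‖g z‖ ≤ Cb) →
      ∀ K : Set ℂ, IsCompact K → K ⊆ D.carrier → (∀ z : ℂ, z ∉ K → g z = 0) →
        ∀ η > (0:ℝ), ∀ᶠ δ in 𝓝[>] (0:ℝ), ‖dbarSum (Λ δ) δ g‖ ≤ η * δ ^ (-(5:ℝ) / 3)

/-! ## Registered stubs -/

/-- **stub_generalWeightedGreen (L, provable now).** [cite: DuminilCopinSmirnov2012Lattice, Proposition 8.6] -/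
theorem stub_generalWeightedGreen : GeneralWeightedGreen := by
  sorry

/-- **stub_cauchyWallLower (M/L, provable now).** [cite: IkhlefPonsaing2012, Prop. 4.7] -/
theorem stub_cauchyWallLower : CauchyWallLower := by
  sorry

/-- **stub_staggerCauchyKernel (XL, OPEN — the honest content of the line).** [cite: DuminilCopinSmirnov2012Lattice, Conjecture 8.7] -/
theorem stub_staggerCauchyKernel : StaggerCauchyKernel := by
  sorry

/-- **stub_compactDbarOfVanishing (M, provable now).** [folklore] -/
theorem stub_compactDbarOfVanishing : CompactDbarOfVanishing := by
  sorry

/-! ## The composition (sorry-free): the discrete Cauchy formula contradicts vertex vanishing -/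

/-- `‖(1 + i)/2‖ ≤ 1`. [folklore] -/
theorem norm_one_add_I_div_two_le : ‖(1 + Complex.I) / 2‖ ≤ 1 := by
  rw [norm_div]
  have h2 : ‖(2:ℂ)‖ = 2 := by simp
  rw [h2, div_le_one (by norm_num : (0:ℝ) < 2)]
  calc ‖1 + Complex.I‖ ≤ ‖(1:ℂ)‖ + ‖Complex.I‖ := norm_add_le _ _
    _ = 2 := by simp; norm_num

/-- `‖(1 − i)/2‖ ≤ 1`. [folklore] -/
theorem norm_one_sub_I_div_two_le : ‖(1 - Complex.I) / 2‖ ≤ 1 := by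
  rw [norm_div]
  have h2 : ‖(2:ℂ)‖ = 2 := by simp
  rw [h2, div_le_one (by norm_num : (0:ℝ) < 2)]
  calc ‖1 - Complex.I‖ ≤ ‖(1:ℂ)‖ + ‖Complex.I‖ := norm_sub_le _ _
    _ = 2 := by simp; norm_num

/-- Along `𝓝[>] 0`, `δ^{-2/3}` eventually dominates any constant multiple. [folklore] -/
theorem eventually_const_le_mul_rpow (C' c : ℝ) (hc : 0 < c) :
    ∀ᶠ δ in 𝓝[>] (0:ℝ), C' ≤ c * δ ^ (-(2:ℝ) / 3) := by
  have h1 : Tendsto (fun δ : ℝ => c * (δ⁻¹) ^ ((2:ℝ) / 3)) (𝓝[>] 0) atTop :=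
    ((tendsto_rpow_atTop (by norm_num : (0:ℝ) < 2 / 3)).comp tendsto_inv_nhdsGT_zero).const_mul_atTop hc
  filter_upwards [h1.eventually_ge_atTop C', self_mem_nhdsWithin] with δ hδ hpos
  rw [Set.mem_Ioi] at hpos
  have e : c * (δ⁻¹) ^ ((2:ℝ) / 3) = c * δ ^ (-(2:ℝ) / 3) := by
    rw [Real.inv_rpow hpos.le, ← Real.rpow_neg hpos.le, neg_div]
  rw [← e]
  exact hδ

/-- **The discrete Cauchy integral formula contradicts vertex vanishing.**  Under `VertexVanishes anchorDomain anchorData`: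
(A) the general weighted Green identity for the cut-off Cauchy kernel reads `‖Wall + (δ/2)(α·dbar − β·stag)‖ ≤ C'` with
`‖α‖, ‖β‖ ≤ 1`; (D) `‖dbar‖ ≤ η δ^{-5/3}` (its weight `∂̄w` is bounded and compactly supported); (C) `‖stag‖ ≤ η δ^{-5/3}`;
hence `‖Wall‖ ≤ C' + η δ^{-2/3}`, against (B) `c δ^{-2/3} ≤ ‖Wall‖`: absurd for `η = c/4` and `δ` small. [folklore] -/
theorem not_vertexVanishes_anchorData_of_cauchy (hA : GeneralWeightedGreen) (hB : CauchyWallLower)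
    (hC : StaggerCauchyKernel) (hD : CompactDbarOfVanishing) : ¬ VertexVanishes anchorDomain anchorData := by
  intro hV
  obtain ⟨w, wd, wdb, C, Cb, K, hT, hCb, hout, hKc, hKsub, hsupp, hstag⟩ := hC
  obtain ⟨c, hc, hwall⟩ := hB
  obtain ⟨C', hid⟩ := hA anchorDomain anchorData stub_anchorData_isFamily w wd wdb C hT
  have hη : (0:ℝ) < c / 4 := by positivity
  have hdbar := hD anchorDomain anchorData stub_anchorData_isFamily hV wdb Cb hCb K hKc hKsub hsupp (c / 4) hη
  have hst := hstag (c / 4) hη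
  have hw := hwall w hout
  have hbig := eventually_const_le_mul_rpow C' (c / 4) hη
  obtain ⟨δ, ⟨⟨⟨⟨hid, hw⟩, hdbar⟩, hst⟩, hbig⟩, hδpos⟩ :=
    (((((hid.and hw).and hdbar).and hst).and hbig).and self_mem_nhdsWithin).exists
  replace hδpos : (0:ℝ) < δ := hδpos
  -- abbreviations
  set Wl : ℂ := wallW (anchorData δ) δ w with hWl
  set Db : ℂ := dbarSum (anchorData δ) δ wdb with hDb
  set St : ℂ := stagSum (anchorData δ) δ wd with hSt
  set P : ℝ := δ ^ (-(5:ℝ) / 3) with hP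
  set Q : ℝ := δ ^ (-(2:ℝ) / 3) with hQ
  have hP0 : 0 ≤ P := (Real.rpow_pos_of_pos hδpos _).le
  have hQ0 : 0 < Q := Real.rpow_pos_of_pos hδpos _
  -- `δ · δ^{-5/3} = δ^{-2/3}`
  have hδP : δ * P = Q := by
    rw [hP, hQ]
    have := Real.rpow_add hδpos 1 (-(5:ℝ) / 3)
    rw [Real.rpow_one] at this
    rw [← this]
    norm_num
  -- the correction term is at most `δ · (‖Db‖ + ‖St‖)/2 ≤ (c/4) δ^{-2/3}`
  have hcorr : ‖((δ : ℂ) / 2) * ((1 + Complex.I) / 2 * Db - (1 - Complex.I) / 2 * St)‖ ≤ c / 4 * Q := by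
    have hδn : ‖((δ : ℂ) / 2)‖ = δ / 2 := by
      rw [norm_div, Complex.norm_real, Real.norm_of_nonneg hδpos.le]
      simp
    have h1 : ‖(1 + Complex.I) / 2 * Db‖ ≤ ‖Db‖ := by
      rw [norm_mul]
      calc ‖(1 + Complex.I) / 2‖ * ‖Db‖ ≤ 1 * ‖Db‖ :=
            mul_le_mul_of_nonneg_right norm_one_add_I_div_two_le (norm_nonneg _)
        _ = ‖Db‖ := one_mul _
    have h2 : ‖(1 - Complex.I) / 2 * St‖ ≤ ‖St‖ := by
      rw [norm_mul]
      calc ‖(1 - Complex.I) / 2‖ * ‖St‖ ≤ 1 * ‖St‖ :=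
            mul_le_mul_of_nonneg_right norm_one_sub_I_div_two_le (norm_nonneg _)
        _ = ‖St‖ := one_mul _
    have h3 : ‖(1 + Complex.I) / 2 * Db - (1 - Complex.I) / 2 * St‖ ≤ ‖Db‖ + ‖St‖ :=
      (norm_sub_le _ _).trans (add_le_add h1 h2)
    calc ‖((δ : ℂ) / 2) * ((1 + Complex.I) / 2 * Db - (1 - Complex.I) / 2 * St)‖
        = δ / 2 * ‖(1 + Complex.I) / 2 * Db - (1 - Complex.I) / 2 * St‖ := by rw [norm_mul, hδn]
      _ ≤ δ / 2 * (‖Db‖ + ‖St‖) := mul_le_mul_of_nonneg_left h3 (by positivity)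
      _ ≤ δ / 2 * (c / 4 * P + c / 4 * P) := by
          apply mul_le_mul_of_nonneg_left (add_le_add hdbar hst) (by positivity)
      _ = c / 4 * (δ * P) := by ring
      _ = c / 4 * Q := by rw [hδP]
  -- hence `‖Wall‖ ≤ C' + (c/4) Q ≤ (c/2) Q`, contradicting `c Q ≤ ‖Wall‖`
  have hWle : ‖Wl‖ ≤ C' + c / 4 * Q := by
    have := norm_le_norm_add_norm_sub' Wl
      (((δ : ℂ) / 2) * ((1 + Complex.I) / 2 * Db - (1 - Complex.I) / 2 * St))
    -- ‖Wl‖ ≤ ‖Wl + T‖ + ‖T‖  (write Wl = (Wl + T) - T)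
    have key : ‖Wl‖ ≤ ‖Wl + ((δ : ℂ) / 2) * ((1 + Complex.I) / 2 * Db - (1 - Complex.I) / 2 * St)‖ +
        ‖((δ : ℂ) / 2) * ((1 + Complex.I) / 2 * Db - (1 - Complex.I) / 2 * St)‖ := by
      have e : Wl = (Wl + ((δ : ℂ) / 2) * ((1 + Complex.I) / 2 * Db - (1 - Complex.I) / 2 * St)) -
          ((δ : ℂ) / 2) * ((1 + Complex.I) / 2 * Db - (1 - Complex.I) / 2 * St) := by ring
      conv_lhs => rw [e]
      exact norm_sub_le _ _
    exact key.trans (add_le_add hid hcorr)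
  have hWge : c * Q ≤ ‖Wl‖ := hw
  have : c * Q ≤ c / 2 * Q := by linarith
  have : c ≤ c / 2 := le_of_mul_le_mul_right this hQ0
  linarith

/-- **`ParafermionFamiliesToSLESix` from the four registered stubs — the skeleton theorem (concludes the crux BY NAME; no
`sorry` of its own): A ∧ B ∧ C ∧ D ⇒ `¬ VertexVanishes anchorDomain anchorData` ⇒ crux, the last step being the landed normal
form `parafermionFamiliesToSLESix_of_not_vertexVanishes_anchorData` (lead c5, p147689).** -/
theorem ParafermionFamiliesToSLESix_of : ParafermionFamiliesToSLESix :=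
  parafermionFamiliesToSLESix_of_not_vertexVanishes_anchorData
    (not_vertexVanishes_anchorData_of_cauchy stub_generalWeightedGreen stub_cauchyWallLower stub_staggerCauchyKernel
      stub_compactDbarOfVanishing)

end Summit.CriticalPhenomena.CardyFormulaZ2.Cruxes.ParafermionFamiliesToSLESix.CauchyKernelStaggerResidue

end
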